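import Mathlib.Data.ENat.Lattice
import Mathlib.GroupTheory.SpecificGroups.Cyclic
import Summits.BirchSwinnertonDyer.BirchSwinnertonDyer.Theorems.Rank1ResidualJetSection6
import Summits.BirchSwinnertonDyer.BirchSwinnertonDyer.Theorems.ClassRecordThreeEulerHalvesAtThreeCoreVertexAdm
import HarnessLib

/-!
# [J] §6 joined kernel (Prop. 6.4 ∘ Thm. 6.3), ADMISSIBILITY-INDEXED form: every per-(conductor, prime)
# hypothesis — lozenge data, sign flip, Prop. 4.7, and block 2's `hsing` ∕ `horth_ℓ` ∕ Prop. 4.9 `h49` —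
# is asked only for the primes `ℓ` admissible at `n` (`Adm n ℓ`), Lemma 6.1 delivering admissible primes
# (cell `bsd-stepL`, seat `bsd-stepL-tam3-p1`, helper toward item 19109 `EulerHalvesAtThree`,
# registered stub `stub_jetchevMaxHLAtThree`)

HONEST FRAMING. Nothing here proves BSD, J₃ or any divisibility; no item closes; 0 classes move (T7);
`--supports stmt-BirchSwinnertonDyer-19109` (helper). WHAT THIS FILE DOES. `tamagawaExponent_le_m_of_selmerFamilies_adm`
= p484791's `tamagawaExponent_le_m_of_selmerFamilies` re-proved over `exists_halfCoreVertex_adm`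
(`…CoreVertexAdm`): the hypotheses `hfin`, `hSel`, `hSelT`, `hPT`, `he`, `h47`, `hsing`, `horth_ℓ`, `h49`
carry `Adm n ℓ` instead of `ℓ ∉ n` (`hAdm : Adm n ℓ → ℓ ∉ n`), and `h61` delivers `ℓ` with `Adm n ℓ`. The
proof is p484791's verbatim (Thm. 6.3 at the half-core vertex uses its hypotheses only at the prime
delivered by `h61`). PURPOSE: see `…CoreVertexAdm` (memo MEMO-J3-v5 §4.2 (a)) — with `Adm n ℓ := ℓ`
above the primes of `c·n`, the instantiation's data can be built along increasing chains by one-step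
compatible extensions, and Prop. 4.7 ∕ 4.9 are needed only there.
References (locators only; no cited FACT declared): [cite: Jetchev2008, Thm. 6.3, Prop. 6.4, Proof of
Thm. 1.4 (pp. 822–825)] [cite: McCallumLMS1991, Cor. 3.2 (p. 299), Prop. 5.2 (p. 304)]. Design: no
definitions; `Type*`-polymorphic; `Nat.card`; ENat. Axioms: `propext`, `Classical.choice`, `Quot.sound`.
-/

set_option autoImplicit false

noncomputable section

open scoped Classical

namespace Summit.BirchSwinnertonDyer.Rank1Residual.JET.Section6

variable {G : Type*} [AddCommGroup G] {P : Type*} [DecidableEq P]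
  {L : P → Type*} [∀ ℓ, AddCommGroup (L ℓ)]

/-- **[J] §6 joined: Thm. 6.3 at the half-core vertex delivered by Prop. 6.4 (`exists_halfCoreVertex`)
— `t = ord_p c_q ≤ m(c)` for every base conductor `c` with `m(c) < k`, `t ≤ k`, carrying the
level-`p^k` families.** The first block of hypotheses is that of `exists_halfCoreVertex` (Kummer
structure: `Sel`, `Rel`, `Hf`, `Htr`, global duality `hPT`, signs `e`, Lemma 6.1 `h61`, the classes
`κ, κ̃` with §3.1 ∕ Prop. 4.7); the second block is, AT EVERY conductor `c·n`, the `−ε(cn)`-side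
stringent data of Thm. 6.3 in the shape of p471669's `tamagawaExponent_le_mInfty_of_minimalCoreVertex`:
`B' n ↦ 𝓗_{𝓕₀(cn)}^{−ε} ≤ 𝓗_{𝓕(cn)}^{−ε}` (`𝓕₀ = 𝓕_⌈q⌉ ≼ 𝓕`), `C' n ↦ 𝓗_{𝓕₀(cn)^*}^{−ε} ≤ H¹(K,E[p^k])^{−ε}`,
Thm. 5.1 at the carrier for `𝓕₀(cn) ≼ 𝓕(cn)` (`locq`, `locq'`, `hker`, `horth_q`) with (δ) `Q' n` cyclic
of order `p^t`, and for every `ℓ ∉ n`: `D' n ℓ ↦ 𝓗_{(𝓕₀)^ℓ(cn)}^{−ε}`, Thm. 5.1 ∕ Lemma 5.2 (iii) at `λ`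
for `𝓕₀(cn) ≼ (𝓕₀)^ℓ(cn)` (`sing`, `hsing`, `horth_ℓ`), and Prop. 4.9 for the conductor `cnℓ`
(`h49 : κ_{cnℓ,k} ∈ D' n ℓ`). CONCLUSION `t ≤ m(c)`. PROOF: `exists_halfCoreVertex` gives `n` with
`𝓗_{𝓕(cn)}^{−ε(cn)} = 0`, `m(cn) ≤ m(c)`; there the printed `−ε` computation of Thm. 6.3 (as in p471669,
adapted to one ambient group with eigen-subgroups) gives `t ≤ m(cn)`. With Kolyvagin's redefinition
of `m_∞` (McCallum 1991 Prop. 5.2: some `c` of arbitrarily large `M(c)` has `m(c) = m_∞`) this is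
`t ≤ m_∞`, i.e. Thm. 1.4 for the carrier `q` — the caller supplies that `c`.
[cite: Jetchev2008, Thm. 6.3, Prop. 6.4, Proof of Thm. 1.4 (pp. 822–825)] [cite: McCallumLMS1991, Prop. 5.2 (p. 304)] -/
theorem tamagawaExponent_le_m_of_selmerFamilies_adm
    {p k t : ℕ} (hp : p.Prime) (htk : t ≤ k)
    -- block 1: the data of `exists_halfCoreVertex`
    (loc : ∀ ℓ : P, G →+ L ℓ) (Hf Htr : ∀ ℓ : P, Bool → AddSubgroup (L ℓ))
    (hdisj : ∀ ℓ s, Disjoint (Hf ℓ s) (Htr ℓ s))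
    (Gs : Bool → AddSubgroup G) (Sel : Finset P → Bool → AddSubgroup G)
    (Rel : Finset P → P → Bool → AddSubgroup G) (hSelGs : ∀ n s, Sel n s ≤ Gs s)
    (Adm : Finset P → P → Prop) (hAdm : ∀ n ℓ, Adm n ℓ → ℓ ∉ n)
    (hfin : ∀ n ℓ s, Adm n ℓ → Finite (Rel n ℓ s))
    (hSel : ∀ n ℓ s, Adm n ℓ → Sel n s = Rel n ℓ s ⊓ (Hf ℓ s).comap (loc ℓ))
    (hSelT : ∀ n ℓ s, Adm n ℓ → Sel (insert ℓ n) s = Rel n ℓ s ⊓ (Htr ℓ s).comap (loc ℓ))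
    (hPT : ∀ n ℓ s, Adm n ℓ → Nat.card ((Rel n ℓ s).map (loc ℓ)) = p ^ k)
    (e : Finset P → Bool) (he : ∀ n ℓ, Adm n ℓ → e (insert ℓ n) = !e n)
    (h61 : ∀ (s : Bool) (x y : G), x ∈ Gs s → y ∈ Gs (!s) → y ≠ 0 → ∀ n : Finset P,
      ∃ ℓ, Adm n ℓ ∧ addOrderOf (loc ℓ x) = addOrderOf x ∧ addOrderOf (loc ℓ y) = addOrderOf y)
    (M mdiv mc : Finset P → ℕ∞) (hm : ∀ n, mdiv n < M n → mc n ≤ mdiv n)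
    (hM : ∀ n, (k : ℕ∞) + mc ∅ ≤ M n)
    (κ κt : Finset P → G)
    (hκt : ∀ n, mc n + k ≤ M n →
      κt n ∈ Sel n (e n) ∧ addOrderOf (κt n) = p ^ k ∧ κ n = p ^ (mc n).toNat • κt n)
    (hordκ : ∀ n (j : ℕ), j < k → p ^ (k - j) ∣ addOrderOf (κ n) → mdiv n ≤ j)
    (h47 : ∀ n ℓ, Adm n ℓ → addOrderOf (loc ℓ (κ (insert ℓ n))) = addOrderOf (loc ℓ (κ n)))
    (h0 : mc ∅ < k)
    -- block 2: the `−ε(cn)`-side stringent data of Thm. 6.3 at every conductor `cn`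
    (B' C' : Finset P → AddSubgroup G) (hB' : ∀ n, B' n ≤ Sel n (!e n))
    (hC'Gs : ∀ n, C' n ≤ Gs (!e n))
    {Q Q' : Finset P → Type*} [∀ n, AddCommGroup (Q n)] [∀ n, AddCommGroup (Q' n)]
    [∀ n, Finite (Q' n)]
    (locq : ∀ n, ↥(Sel n (!e n)) →+ Q n) (locq' : ∀ n, ↥(C' n) →+ Q' n)
    (hker : ∀ n (x : C' n), locq' n x = 0 ↔ (x : G) ∈ Sel n (!e n))
    (horth_q : ∀ n, Nat.card (locq n).range * Nat.card (locq' n).range = Nat.card (Q' n))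
    (hQ'cyc : ∀ n, IsAddCyclic (Q' n)) (hQ'card : ∀ n, Nat.card (Q' n) = p ^ t)
    (D' : Finset P → P → AddSubgroup G)
    {S : Finset P → P → Type*} [∀ n ℓ, AddCommGroup (S n ℓ)] (sing : ∀ n ℓ, ↥(D' n ℓ) →+ S n ℓ)
    (hsing : ∀ n ℓ (x : D' n ℓ), Adm n ℓ → (sing n ℓ x = 0 ↔ (x : G) ∈ B' n))
    (horth_ℓ : ∀ n ℓ, Adm n ℓ →
      Nat.card (sing n ℓ).range * Nat.card ((C' n).map (loc ℓ)) = p ^ k)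
    (h49 : ∀ n ℓ, Adm n ℓ → κ (insert ℓ n) ∈ D' n ℓ) :
    (t : ℕ∞) ≤ mc ∅ := by
  -- trivial when `t = 0`
  rcases Nat.eq_zero_or_pos t with ht0 | ht0
  · simp [ht0]
  -- Prop. 6.4: a half-core vertex `cn` with `m(cn) ≤ m(c)`
  obtain ⟨n, hcore, hn⟩ := exists_halfCoreVertex_adm hp loc Hf Htr hdisj Gs Sel Rel hSelGs Adm hAdm hfin
    hSel hSelT hPT e he h61 M mdiv mc hm hM κ κt hκt hordκ h47 h0
  -- bookkeeping at `cn`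
  have hk0 : 0 < k := lt_of_lt_of_le ht0 htk
  have hmcn_lt : mc n < (k : ℕ∞) := lt_of_le_of_lt hn h0
  have hmcn_ne : mc n ≠ ⊤ := ne_top_of_lt hmcn_lt
  set u : ℕ := (mc n).toNat with hu
  have hmcu : mc n = (u : ℕ∞) := (ENat.coe_toNat hmcn_ne).symm
  have huk : u < k := by
    have : ((u : ℕ) : ℕ∞) < (k : ℕ∞) := hmcu ▸ hmcn_lt
    exact_mod_cast this
  have hMn : mc n + k ≤ M n :=
    calc mc n + (k : ℕ∞) ≤ mc ∅ + k := add_le_add hn le_rfl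
      _ = (k : ℕ∞) + mc ∅ := add_comm _ _
      _ ≤ M n := hM n
  obtain ⟨hκtSel, hκtord, hκeq⟩ := hκt n hMn
  -- it suffices to prove `t ≤ m(cn)`
  suffices htu : t ≤ u by
    calc (t : ℕ∞) ≤ (u : ℕ∞) := by exact_mod_cast htu
      _ = mc n := hmcu.symm
      _ ≤ mc ∅ := hn
  -- Thm. 6.3 at `cn`, `−ε(cn)` side (the printed computation, as in p471669)
  -- `B' = 0`
  have hB'0 : B' n = ⊥ := le_bot_iff.mp (hcore ▸ hB' n)
  -- `locq` has trivial source, so `#im locq' = #Q' = p^t`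
  have hrange_q : Nat.card (locq n).range = 1 := by
    have : (locq n).range = ⊥ := by
      rw [eq_bot_iff]
      rintro _ ⟨x, rfl⟩
      have hx : (x : G) ∈ (⊥ : AddSubgroup G) := hcore ▸ x.2
      have : x = 0 := by ext; simpa using hx
      simp [this]
    rw [this, AddSubgroup.card_bot]
  have horth := horth_q n
  rw [hrange_q, one_mul, hQ'card n] at horth
  -- `locq'` is injective (kernel `= 𝓗_{𝓕(cn)}^{−ε} = 0`)
  have hinj : Function.Injective (locq' n) := by
    rw [injective_iff_map_eq_zero]
    intro x hx
    have hx' : (x : G) ∈ (⊥ : AddSubgroup G) := hcore ▸ (hker n x).mp hx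
    ext; simpa using hx'
  -- hence `C' n` is cyclic of order `p^t`, generated by some `g`
  haveI : IsAddCyclic (Q' n) := hQ'cyc n
  haveI : IsAddCyclic (C' n) := isAddCyclic_of_injective (locq' n) hinj
  have hcardC' : Nat.card (C' n) = p ^ t := by
    rw [← horth]; exact Nat.card_congr (AddMonoidHom.ofInjective hinj).toEquiv
  obtain ⟨g, hg⟩ := IsAddCyclic.exists_generator (α := C' n)
  have hordg : addOrderOf (g : G) = p ^ t := by
    rw [AddSubgroup.addOrderOf_coe, addOrderOf_eq_card_of_forall_mem_zmultiples hg, hcardC']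
  have hg0 : (g : G) ≠ 0 := by
    intro h
    rw [h, addOrderOf_zero] at hordg
    have : 1 < p ^ t := Nat.one_lt_pow ht0.ne' hp.one_lt
    omega
  have hC'eq : C' n = AddSubgroup.zmultiples (g : G) := by
    apply le_antisymm
    · intro x hx
      obtain ⟨j, hj⟩ := AddSubgroup.mem_zmultiples_iff.mp (hg ⟨x, hx⟩)
      exact AddSubgroup.mem_zmultiples_iff.mpr ⟨j, by simpa using congrArg Subtype.val hj⟩
    · exact AddSubgroup.zmultiples_le_of_mem g.2
  -- Lemma 6.1 for (`κ̃_{cn}` on the `ε(cn)` side, `g` on the `−ε(cn)` side), `ℓ ∉ n`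
  obtain ⟨ℓ, hℓn, hℓx, hℓg⟩ :=
    h61 (e n) (κt n) (g : G) (hSelGs _ _ hκtSel) (hC'Gs n g.2) hg0 n
  rw [hκtord] at hℓx
  rw [hordg] at hℓg
  -- `#loc_λ(C') = p^t`, so `#D' n ℓ = p^(k - t)`
  have hcard_img : Nat.card ((C' n).map (loc ℓ)) = p ^ t := by
    rw [hC'eq, AddMonoidHom.map_zmultiples, Nat.card_zmultiples, hℓg]
  have hsing_inj : Function.Injective (sing n ℓ) := by
    rw [injective_iff_map_eq_zero]
    intro x hx
    have hx' : (x : G) ∈ (⊥ : AddSubgroup G) := hB'0 ▸ (hsing n ℓ x hℓn).mp hx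
    ext; simpa using hx'
  have hcardD : Nat.card (D' n ℓ) = p ^ (k - t) := by
    have h1 : Nat.card (D' n ℓ) = Nat.card (sing n ℓ).range :=
      Nat.card_congr (AddMonoidHom.ofInjective hsing_inj).toEquiv
    have h2 := horth_ℓ n ℓ hℓn
    rw [hcard_img, ← h1, ← Nat.sub_add_cancel htk, pow_add] at h2
    exact Nat.eq_of_mul_eq_mul_right (pow_pos hp.pos t) h2
  -- the order of `loc_λ κ_{cnℓ}` divides `p^(k - t)` (Prop. 4.9: `κ_{cnℓ} ∈ D'`) …
  have hdvd : addOrderOf (loc ℓ (κ (insert ℓ n))) ∣ p ^ (k - t) :=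
    hcardD ▸ addOrderOf_map_dvd_card_of_mem (loc ℓ) (D' n ℓ) (h49 n ℓ hℓn)
  -- … and equals `ord loc_λ κ_{cn} = p^(k - m(cn))` (Prop. 4.7, §3.1 item 7)
  have hordκ' : addOrderOf (loc ℓ (κ n)) = p ^ (k - u) := by
    rw [hκeq, map_nsmul]
    exact addOrderOf_pow_nsmul_eq hp huk.le _ hℓx
  rw [h47 n ℓ hℓn, hordκ', Nat.pow_dvd_pow_iff_le_right hp.one_lt] at hdvd
  omega

end Summit.BirchSwinnertonDyer.Rank1Residual.JET.Section6

end
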